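import Mathlib.RingTheory.Length
import Mathlib.RingTheory.Ideal.Height
import Mathlib.RingTheory.Ideal.UFD
import Mathlib.RingTheory.UniqueFactorizationDomain.Ideal
import Mathlib.RingTheory.Coprime.Lemmas
import Mathlib.LinearAlgebra.Dimension.Localization
import Mathlib.LinearAlgebra.Dimension.Finite
import Literature.NumberTheory.EllipticCurves.IwasawaAlgebraProofs
import Literature.NumberTheory.EllipticCurves.IwasawaAlgebraCharIdealProofs
import Literature.NumberTheory.EllipticCurves.IwasawaAlgebraMuAdditiveProofs
import HarnessLib

/-!
# Characteristic ideals: from length inequalities at height-one primes to divisibility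

Generic commutative algebra (everything PROVED, nothing assumed) supporting the reduction of
K. Kato, *`p`-adic Hodge theory and values of zeta functions of modular forms*, Astérisque 295
(2004), Thm. 17.4 (2) — which is PRINTED as a family of length inequalities
`length_{Λ_𝔭}(X_𝔭) ≤ ord_𝔭(L)` over the height-one primes `𝔭 ∌ p` of `Λ` (p. 273) — to the
divisibility "`p^m · L ∈ char_Λ X`" in which the tree consumes it
(`Literature.NumberTheory.EllipticCurves.kato_divisibility`, conclusion 2, file `PAdicBSD`), together
with the small pieces of module theory used in Kato's §17.13 (tree file
`KatoDivisibilitySkeletonProofs`).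

* `Module.lengthAt_le_of_injective` / `Module.lengthAt_le_of_surjective` /
  `Module.lengthAt_eq_add_quotient`: monotonicity and additivity of the local length
  `lengthAt R M 𝔭 = length_{R_𝔭} M_𝔭` (localisation is exact; Bourbaki AC II §2.4, VII §4.5).
* `Module.isTorsion_of_exact`: torsion modules are closed under extensions.
* `Module.lengthAt_quotient_span_singleton_pow_mul`, `Module.pow_dvd_of_le_lengthAt_quotient`:
  for a prime element `π` of a Noetherian domain and `G = π^e · a`, `π ∤ a`, the local length of
  `R/(G)` at `(π)` is `e`; hence `n ≤ length_{R_(π)} (R/G)_(π) ⇒ πⁿ ∣ G` ("`ord_𝔭`" of Kato,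
  §17.4, is the `𝔭`-adic valuation).
* `Module.isRelPrime_pow_of_not_associated`: powers of non-associated primes are relatively prime.
* `Module.exists_pow_mul_mem_charIdeal_of_lengthAt_le` (**the bridge**): over a Noetherian UFD
  (e.g. `Λ = ℤ_p⟦T⟧`), if a finitely generated torsion module `X` satisfies
  `length X_𝔭 ≤ length (R/G)_𝔭` at every height-one prime `𝔭` not containing a fixed prime
  element `π₀` (for Kato: `π₀ = p`), then `π₀^m · G ∈ char(X)` for some `m`
  (`char(X) = ∏_{ht 𝔭 = 1} 𝔭^{length X_𝔭}`, `Literature.NumberTheory.EllipticCurves.Module.charIdeal`).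
* `Module.ker_eq_bot_of_rank_le_one`: a linear map out of a torsion-free module of rank `≤ 1`
  which takes some element to a non-torsion element is injective (step (17.13.2) of Kato's proof:
  "since `H¹(T(k))` has no `Λ`-torsion and is of `Λ`-rank 1 (12.4), it is sufficient to show that
  the image … is of `Λ`-rank 1", p. 279).

References: N. Bourbaki, *Algèbre commutative* VII §4.4–4.5; L. Washington, *Introduction to
Cyclotomic Fields*, §13.2; K. Kato, Astérisque 295 (2004), §17.4, §17.13 (pp. 273, 279–280).
Mathlib supplies: `Module.length` and its exactness lemmas, `LocalizedModule.map_injective/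
surjective/exact`, `WfDvdMonoid.max_power_factor`, `dvd_prime_pow`, `Finset.prod_dvd_of_isRelPrime`,
`Ideal.eq_span_singleton_of_height_eq_one`, `Ideal.IsPrime.exists_mem_prime_of_ne_bot`,
`rank_quotient_add_rank_of_isDomain` (rank–nullity over a domain), `rank_zero_iff`.
-/

noncomputable section

namespace Literature.NumberTheory.EllipticCurves

namespace Module

/-! ### Local lengths: monotonicity and additivity -/

section Monotone

variable {R : Type*} [CommRing R] {M N P : Type*} [AddCommGroup M] [_root_.Module R M]
  [AddCommGroup N] [_root_.Module R N] [AddCommGroup P] [_root_.Module R P]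

/-- `length_{R_𝔭} M_𝔭 ≤ length_{R_𝔭} N_𝔭` for `M ↪ N` (localisation is exact;
Bourbaki AC II §2.4). [folklore] -/
theorem lengthAt_le_of_injective (f : M →ₗ[R] N) (hf : Function.Injective f)
    (𝔭 : PrimeSpectrum R) : lengthAt R M 𝔭 ≤ lengthAt R N 𝔭 :=
  _root_.Module.length_le_of_injective (LocalizedModule.map 𝔭.asIdeal.primeCompl f)
    (LocalizedModule.map_injective _ f hf)

/-- `length_{R_𝔭} N_𝔭 ≤ length_{R_𝔭} M_𝔭` for `M ↠ N` (localisation is exact;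
Bourbaki AC II §2.4). [folklore] -/
theorem lengthAt_le_of_surjective (f : M →ₗ[R] N) (hf : Function.Surjective f)
    (𝔭 : PrimeSpectrum R) : lengthAt R N 𝔭 ≤ lengthAt R M 𝔭 :=
  _root_.Module.length_le_of_surjective (LocalizedModule.map 𝔭.asIdeal.primeCompl f)
    (LocalizedModule.map_surjective _ f hf)

/-- The local length of a submodule is at most that of the module. [folklore] -/
theorem lengthAt_submodule_le (M' : Submodule R M) (𝔭 : PrimeSpectrum R) :
    lengthAt R M' 𝔭 ≤ lengthAt R M 𝔭 :=
  lengthAt_le_of_injective M'.subtype M'.injective_subtype 𝔭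

/-- The local length of a quotient module is at most that of the module. [folklore] -/
theorem lengthAt_quotient_le (M' : Submodule R M) (𝔭 : PrimeSpectrum R) :
    lengthAt R (M ⧸ M') 𝔭 ≤ lengthAt R M 𝔭 :=
  lengthAt_le_of_surjective M'.mkQ (Submodule.mkQ_surjective M') 𝔭

/-- `length M_𝔭 = length M'_𝔭 + length (M/M')_𝔭` (Bourbaki AC VII §4.5 Prop. 10, local form).
[folklore] -/
theorem lengthAt_eq_add_quotient (M' : Submodule R M) (𝔭 : PrimeSpectrum R) :
    lengthAt R M 𝔭 = lengthAt R M' 𝔭 + lengthAt R (M ⧸ M') 𝔭 :=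
  lengthAt_eq_add_of_exact M'.subtype M'.mkQ M'.injective_subtype (Submodule.mkQ_surjective M')
    (LinearMap.exact_subtype_mkQ M') 𝔭

/-- For an exact pair `M' → M → M''` (exact at `M`):
`length M_𝔭 ≤ length M'_𝔭 + length M''_𝔭`. [folklore] -/
theorem lengthAt_le_add_of_exact (f : P →ₗ[R] M) (g : M →ₗ[R] N) (hfg : Function.Exact f g)
    (𝔭 : PrimeSpectrum R) : lengthAt R M 𝔭 ≤ lengthAt R P 𝔭 + lengthAt R N 𝔭 := by
  rw [lengthAt_eq_add_quotient (LinearMap.range f) 𝔭]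
  refine add_le_add (lengthAt_le_of_surjective f.rangeRestrict f.surjective_rangeRestrict 𝔭) ?_
  -- `M / range f = M / ker g ≃ range g ↪ N`
  have hker : LinearMap.ker g = LinearMap.range f := LinearMap.exact_iff.mp hfg
  rw [← hker]
  exact (lengthAt_eq_of_linearEquiv g.quotKerEquivRange 𝔭).trans_le
    (lengthAt_submodule_le (LinearMap.range g) 𝔭)

end Monotone

/-! ### Torsion modules are closed under extensions -/

section Torsion

variable {R : Type*} [CommRing R] {M M' M'' : Type*} [AddCommGroup M] [_root_.Module R M]
  [AddCommGroup M'] [_root_.Module R M'] [AddCommGroup M''] [_root_.Module R M'']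

/-- If `M' → M → M''` is exact at `M` and `M'`, `M''` are torsion modules, so is `M`
(the non-zero-divisors form a multiplicative set). [folklore] -/
theorem isTorsion_of_exact (f : M' →ₗ[R] M) (g : M →ₗ[R] M'') (hfg : Function.Exact f g)
    (h' : Module.IsTorsion R M') (h'' : Module.IsTorsion R M'') : Module.IsTorsion R M := by
  intro x
  obtain ⟨a, ha⟩ := @h'' (g x)
  have hx : g ((a : R) • x) = 0 := by rw [map_smul, ← Submonoid.smul_def, ha]
  obtain ⟨y, hy⟩ := (hfg ((a : R) • x)).mp hx
  obtain ⟨b, hb⟩ := @h' y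
  refine ⟨b * a, ?_⟩
  rw [Submonoid.smul_def, Submonoid.coe_mul, mul_smul, ← hy, ← map_smul, ← Submonoid.smul_def, hb,
    map_zero]

end Torsion

/-! ### `ord_𝔭` as a local length: `n ≤ length (R/G)_(π) ⇒ πⁿ ∣ G` -/

section Ord

variable {R : Type*} [CommRing R] [IsDomain R]

/-- For a prime element `π`, `π ∤ a`, and `𝔭 = (π)`: `length_{R_𝔭} (R/(π^e a))_𝔭 = e`.
[folklore] -/
theorem lengthAt_quotient_span_singleton_pow_mul {π a : R} (hπ : Prime π) (e : ℕ) (ha : ¬ π ∣ a)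
    (𝔭 : PrimeSpectrum R) (h𝔭 : 𝔭.asIdeal = Ideal.span {π}) :
    lengthAt R (R ⧸ Ideal.span {π ^ e * a}) 𝔭 = e := by
  rw [lengthAt_quotient_span_singleton_mul a (pow_ne_zero e hπ.ne_zero) 𝔭,
    lengthAt_quotient_span_singleton_pow hπ.ne_zero e 𝔭,
    lengthAt_quotient_eq_zero_of_not_le (I := Ideal.span {a})
      (by rwa [h𝔭, Ideal.span_singleton_le_span_singleton]), add_zero]
  have h1 : lengthAt R (R ⧸ Ideal.span {π}) 𝔭 = 1 := by
    rw [← h𝔭]; exact lengthAt_quotient_self 𝔭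
  rw [h1, nsmul_eq_mul, mul_one]

/-- **`ord_𝔭` is the valuation.** In a Noetherian domain, for a prime element `π`, `𝔭 = (π)` and
`G ≠ 0`: if `n ≤ length_{R_𝔭} (R/(G))_𝔭` then `πⁿ ∣ G` (write `G = π^e a` with `π ∤ a`,
`WfDvdMonoid.max_power_factor`; the length is `e`). [folklore] -/
theorem pow_dvd_of_le_lengthAt_quotient [IsNoetherianRing R] {π G : R} (hπ : Prime π)
    (hG : G ≠ 0) (𝔭 : PrimeSpectrum R) (h𝔭 : 𝔭.asIdeal = Ideal.span {π}) {n : ℕ}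
    (hn : (n : ℕ∞) ≤ lengthAt R (R ⧸ Ideal.span {G}) 𝔭) : π ^ n ∣ G := by
  obtain ⟨e, a, ha, rfl⟩ := WfDvdMonoid.max_power_factor hG hπ.irreducible
  rw [lengthAt_quotient_span_singleton_pow_mul hπ e ha 𝔭 h𝔭, Nat.cast_le] at hn
  exact (pow_dvd_pow π hn).trans (dvd_mul_right _ _)

/-- Powers of non-associated prime elements are relatively prime. [folklore] -/
theorem isRelPrime_pow_of_not_associated {π ρ : R} (hπ : Prime π) (hρ : Prime ρ)
    (h : ¬ Associated π ρ) (a b : ℕ) : IsRelPrime (π ^ a) (ρ ^ b) := by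
  intro d hdπ hdρ
  obtain ⟨i, -, hi⟩ := (dvd_prime_pow hπ a).mp hdπ
  rcases Nat.eq_zero_or_pos i with rfl | hipos
  · rw [pow_zero] at hi
    exact hi.isUnit_iff.mpr isUnit_one
  · exfalso
    have hπd : π ∣ d := (dvd_pow_self π hipos.ne').trans hi.symm.dvd
    exact h (hπ.associated_of_dvd hρ (hπ.dvd_of_dvd_pow (hπd.trans hdρ)))

end Ord

/-! ### The bridge: length inequalities at the height-one primes `𝔭 ∌ π₀` ⇒ `π₀^m G ∈ char X` -/

section Bridge

variable {R : Type*} [CommRing R] [IsDomain R] [IsNoetherianRing R] [UniqueFactorizationMonoid R]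
  {X : Type*} [AddCommGroup X] [_root_.Module R X]

/-- **From Kato's printed form of Thm. 17.4 (2) to divisibility.** Let `R` be a Noetherian UFD,
`X` a finitely generated torsion `R`-module, `π₀` a prime element and `G ≠ 0`. If
`length_{R_𝔭} X_𝔭 ≤ length_{R_𝔭} (R/(G))_𝔭` for every height-one prime `𝔭` with `π₀ ∉ 𝔭`, then
`π₀ ^ m * G ∈ char(X)` for some `m : ℕ` (one may take `m = length X_{(π₀)}`). Proof: `char(X)` is
the finite product `∏_{𝔭 ∈ S} 𝔭^{n_𝔭}` over the height-one support `S` of `X`; each such `𝔭` is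
`(π_𝔭)` for a prime element `π_𝔭`, so `char(X) = (∏ π_𝔭^{n_𝔭})`; for `𝔭 ≠ (π₀)` the
hypothesis and `pow_dvd_of_le_lengthAt_quotient` give `π_𝔭^{n_𝔭} ∣ G`, and these pairwise
relatively prime prime powers divide `G` jointly, while the factor at `(π₀)` divides `π₀^m`.
(Kato, Astérisque 295, Thm. 17.4 (2), p. 273, states the length inequalities; the tree's
`kato_divisibility` (2) states the divisibility; this lemma is the passage between them,
cf. Washington §13.2.) [folklore] -/
theorem exists_pow_mul_mem_charIdeal_of_lengthAt_le [Module.Finite R X]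
    (hX : Module.IsTorsion R X) {π₀ : R} (hπ₀ : Prime π₀) {G : R} (hG : G ≠ 0)
    (h : ∀ 𝔭 : PrimeSpectrum R, 𝔭.asIdeal.height = 1 → π₀ ∉ 𝔭.asIdeal →
      lengthAt R X 𝔭 ≤ lengthAt R (R ⧸ Ideal.span {G}) 𝔭) :
    ∃ m : ℕ, π₀ ^ m * G ∈ charIdeal R X := by
  classical
  -- one `s ≠ 0` kills the finitely generated torsion module `X`
  obtain ⟨s, hsann, hs0⟩ := Submodule.annihilator_top_inter_nonZeroDivisors hX
  have hs : s ≠ 0 := nonZeroDivisors.ne_zero hs0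
  have hsX : Module.IsTorsionBy R X s := fun x =>
    Submodule.mem_annihilator.mp hsann x Submodule.mem_top
  -- `char X` is a finite product over the height-one support `t`
  set F : PrimeSpectrum R → Ideal R := fun 𝔭 => 𝔭.asIdeal ^ (lengthAt R X 𝔭).toNat with hF
  have hfin := finite_heightOne_inter_mulSupport hs hsX
  set t : Finset (PrimeSpectrum R) := hfin.toFinset with ht
  have hchar : charIdeal R X = ∏ 𝔭 ∈ t, F 𝔭 := by
    unfold charIdeal
    refine finprod_mem_eq_prod_of_inter_mulSupport_eq F ?_
    rw [ht, Set.Finite.coe_toFinset, Set.inter_assoc, Set.inter_self]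
  -- every `𝔭 ∈ t` has height one and contains `s`, hence is generated by a prime element
  have hmem : ∀ 𝔭 ∈ t, 𝔭.asIdeal.height = 1 ∧ s ∈ 𝔭.asIdeal := by
    intro 𝔭 h𝔭
    rw [ht, Set.Finite.mem_toFinset] at h𝔭
    refine ⟨h𝔭.1, ?_⟩
    by_contra hns
    exact h𝔭.2 (by simp [lengthAt_eq_zero_of_isTorsionBy hsX 𝔭 hns])
  have hgen : ∀ 𝔭 ∈ t, ∃ π : R, Prime π ∧ 𝔭.asIdeal = Ideal.span {π} := by
    intro 𝔭 h𝔭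
    obtain ⟨h1, hs𝔭⟩ := hmem 𝔭 h𝔭
    have hne : 𝔭.asIdeal ≠ ⊥ := fun hbot => hs (by rwa [hbot, Ideal.mem_bot] at hs𝔭)
    obtain ⟨π, hπ𝔭, hπ⟩ := Ideal.IsPrime.exists_mem_prime_of_ne_bot 𝔭.isPrime hne
    exact ⟨π, hπ, Ideal.eq_span_singleton_of_height_eq_one h1 hπ𝔭 hπ⟩
  choose! π hπ hπeq using hgen
  set n : PrimeSpectrum R → ℕ := fun 𝔭 => (lengthAt R X 𝔭).toNat with hn
  have hchar' : charIdeal R X = Ideal.span {∏ 𝔭 ∈ t, π 𝔭 ^ n 𝔭} := by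
    rw [hchar, ← Ideal.prod_span_singleton]
    refine Finset.prod_congr rfl fun 𝔭 h𝔭 => ?_
    simp only [F, n]
    rw [hπeq 𝔭 h𝔭, Ideal.span_singleton_pow]
  -- split the product according to whether `π₀ ∈ 𝔭`
  refine ⟨∑ 𝔭 ∈ t with π₀ ∈ 𝔭.asIdeal, n 𝔭, ?_⟩
  rw [hchar', Ideal.mem_span_singleton,
    ← Finset.prod_filter_mul_prod_filter_not t (fun 𝔭 => π₀ ∈ 𝔭.asIdeal)]
  refine mul_dvd_mul ?_ ?_
  · -- the factors at primes containing `π₀` (there is at most one, `(π₀)`) divide `π₀ ^ m`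
    rw [← Finset.prod_pow_eq_pow_sum]
    refine Finset.prod_dvd_prod_of_dvd _ _ fun 𝔭 h𝔭 => ?_
    rw [Finset.mem_filter] at h𝔭
    refine (Associated.pow_pow ?_).dvd
    -- `𝔭 = (π₀) = (π 𝔭)`
    have h0 : 𝔭.asIdeal = Ideal.span {π₀} :=
      Ideal.eq_span_singleton_of_height_eq_one (hmem 𝔭 h𝔭.1).1 h𝔭.2 hπ₀
    exact Ideal.span_singleton_eq_span_singleton.mp ((hπeq 𝔭 h𝔭.1).symm.trans h0)
  · -- the other factors are pairwise relatively prime and each divides `G`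
    refine Finset.prod_dvd_of_isRelPrime ?_ ?_
    · intro 𝔭 h𝔭 𝔮 h𝔮 hne
      rw [Finset.coe_filter] at h𝔭 h𝔮
      refine isRelPrime_pow_of_not_associated (hπ 𝔭 h𝔭.1) (hπ 𝔮 h𝔮.1) (fun hass => hne ?_) _ _
      exact PrimeSpectrum.ext
        ((hπeq 𝔭 h𝔭.1).trans ((Ideal.span_singleton_eq_span_singleton.mpr hass).trans
          (hπeq 𝔮 h𝔮.1).symm))
    · intro 𝔭 h𝔭
      rw [Finset.mem_filter] at h𝔭
      refine pow_dvd_of_le_lengthAt_quotient (hπ 𝔭 h𝔭.1) hG 𝔭 (hπeq 𝔭 h𝔭.1) ?_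
      -- `n 𝔭 = length X_𝔭 ≤ length (R/G)_𝔭` (the length is finite)
      have hfinlen : lengthAt R X 𝔭 ≠ ⊤ :=
        lengthAt_ne_top_of_isTorsionBy hs hsX 𝔭 (le_of_eq (hmem 𝔭 h𝔭.1).1)
      calc ((n 𝔭 : ℕ) : ℕ∞) = lengthAt R X 𝔭 := ENat.coe_toNat hfinlen
        _ ≤ _ := h 𝔭 (hmem 𝔭 h𝔭.1).1 h𝔭.2

end Bridge

/-! ### Rank one and torsion-free: a map with a non-torsion value is injective -/

section RankOne

variable {R : Type*} [CommRing R] [IsDomain R] {H P : Type*} [AddCommGroup H] [_root_.Module R H]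
  [AddCommGroup P] [_root_.Module R P]

/-- An element `x` with `a • x = 0 ⇒ a = 0` spans a copy of `R`: `1 ≤ rank M`. [folklore] -/
theorem one_le_rank_of_smul_eq_zero_imp {M : Type*} [AddCommGroup M] [_root_.Module R M]
    (x : M) (hx : ∀ a : R, a • x = 0 → a = 0) : (1 : Cardinal) ≤ Module.rank R M := by
  have hli : LinearIndependent R (fun _ : Fin 1 => x) := by
    rw [Fintype.linearIndependent_iff]
    intro g hg i
    rw [Fin.sum_univ_one] at hg
    rw [Subsingleton.elim i 0]
    exact hx _ hg
  simpa using hli.cardinal_lift_le_rank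

/-- **(17.13.2) of Kato's proof, abstractly.** Let `H` be a torsion-free module of rank `≤ 1`
over a domain and `f : H → P` a linear map such that some `f x` is a non-torsion element of `P`
(`a • f x = 0 ⇒ a = 0`). Then `f` is injective: by rank–nullity over a domain
(`rank (H/ker f) + rank (ker f) = rank H ≤ 1`) and `rank (H/ker f) ≥ 1`, the torsion-free module
`ker f` has rank `0`, hence vanishes. (Kato, Astérisque 295, §17.13, p. 279: "since `H¹(T(k))` has
no `Λ`-torsion and is of `Λ`-rank 1 (12.4), it is sufficient to show that the image … is of
`Λ`-rank 1".) [cite: Kato2004, §17.13 (p. 279)] -/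
theorem ker_eq_bot_of_rank_le_one [Module.IsTorsionFree R H] (hH : Module.rank R H ≤ 1)
    (f : H →ₗ[R] P) (x : H) (hx : ∀ a : R, a • f x = 0 → a = 0) : LinearMap.ker f = ⊥ := by
  -- `1 ≤ rank (H ⧸ ker f)`: the class of `x` is a non-torsion element
  have h1 : (1 : Cardinal) ≤ Module.rank R (H ⧸ LinearMap.ker f) := by
    refine one_le_rank_of_smul_eq_zero_imp (Submodule.Quotient.mk x) fun a ha => hx a ?_
    rw [← Submodule.Quotient.mk_smul, Submodule.Quotient.mk_eq_zero, LinearMap.mem_ker,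
      map_smul] at ha
    exact ha
  -- rank–nullity: `rank (H/ker f) + rank (ker f) = rank H ≤ 1`, so `rank (ker f) = 0`
  have hsum := rank_quotient_add_rank_of_isDomain (LinearMap.ker f)
  have hker0 : Module.rank R (LinearMap.ker f) = 0 := by
    by_contra hne
    have h1' : (1 : Cardinal) ≤ Module.rank R (LinearMap.ker f) :=
      Cardinal.one_le_iff_ne_zero.mpr hne
    have h2 : (1 : Cardinal) + 1 ≤ Module.rank R H := hsum ▸ add_le_add h1 h1'
    have : (1 : Cardinal) + 1 ≤ 1 := h2.trans hH
    norm_num at this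
  exact (Submodule.eq_bot_iff _).mpr fun y hy => by
    have hsub : Subsingleton (LinearMap.ker f) := rank_zero_iff.mp hker0
    exact congrArg Subtype.val (Subsingleton.elim (⟨y, hy⟩ : LinearMap.ker f) 0)

/-- The same, as injectivity. [cite: Kato2004, §17.13 (p. 279)] -/
theorem injective_of_rank_le_one [Module.IsTorsionFree R H] (hH : Module.rank R H ≤ 1)
    (f : H →ₗ[R] P) (x : H) (hx : ∀ a : R, a • f x = 0 → a = 0) : Function.Injective f :=
  LinearMap.ker_eq_bot.mp (ker_eq_bot_of_rank_le_one hH f x hx)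

end RankOne

end Module

end Literature.NumberTheory.EllipticCurves
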